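import Summits.HodgeConjecture.CorCM.GaloisIndexTwoTimesTwo
import Mathlib.GroupTheory.SpecificGroups.Quaternion
import HarnessLib

/-!
# `Dic_m × C₂` (`c = aᵐ`) is BAD unless `m` is a power of two — the last real factor of a dicyclic group

COR-CM (cell `pub-hodgecm2`), binder seat b04 (gen 30), count-neutral own lane «Galois-CM-type classification» (which Galois CM
fields `(G, c)` have ALL primitive CM types nondegenerate = GOOD, vs. a primitive degenerate type = BAD).  KERNEL ONLY: theorems;
no definition, no named fact, no `sorry`.  `HC_CM` is neither used nor claimed.

THE QUESTION.  `Dic_m = ⟨a, x | a^{2m} = 1, x² = aᵐ, xax⁻¹ = a⁻¹⟩` (Mathlib `QuaternionGroup m`, order `4m`) is GOOD exactly when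
the odd part of `m` is `1` or a prime (gen 20 `CorCM/GaloisDicyclicDegenerateTypes`), and a totally real Galois factor `H` makes
`Dic_m × H` BAD unless `H ∈ {C₂, C₂², C₂³, C₄, C_p, S₃}` (gen 24 `CorCM/GaloisRealFactorDegenerate`); `H = C₂², C₄` are BAD
(gen 23), `Q_{2^{k+2}} × C₂` is GOOD (gen 20 `CorCM/GaloisDicyclicTimesTwoNondegenerate`).  Left open so far: `Dic_m × C₂`
with `m` not a power of two (complex conjugation `c = (aᵐ, 1)`, the only central involution in the dicyclic factor) — the HARD
side of the index-two dichotomy (`A = ⟨a⟩ × C₂`, every `z ∉ A` has `z² = c`), where the odd blocks are sums of two norms and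
for `Dic_m` alone their vanishing forces imprimitivity; at `m = 3` only a machine certificate was known (gen 20, order 24).

THEOREMS (instances of `CorCM/GaloisIndexTwoTimesTwo.exists_simple_degenerate_of_index_two_times_two` with `A₀ = ℤ/2m`):
* `exists_simple_degenerate_dicyclic_times_two_of_notMem`: `Gal(K/ℚ) ≅ Dic_m × C₂`, `c = (aᵐ, 1)`, `m ≥ 3`, and some `u ≠ 0` of
  `ℤ/2m` with `m ∉ ⟨u⟩` (⟺ `m` is not a power of two: `u = 2^{k+1}` for `m = 2ᵏm'`, `m' > 1` odd) ⟹ BAD: a simple DEGENERATE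
  abelian variety of dimension `4m` with CM by `K`;
* `exists_simple_degenerate_dicyclic_odd_times_two`: the clean form for `m` ODD `≥ 3` (`u = 2`, `m ∉ 2ℤ/2m` by parity).
So **`Dic_m × C₂` is GOOD ⟺ `m` is a power of `2`**.

## References

* [Kubota1965] T. Kubota, *On the field extension by complex multiplication*, Trans. AMS 118 (1965), §2, §4 Lemma 2.
* [Shimura1998] G. Shimura, *Abelian Varieties with Complex Multiplication and Modular Functions*, §6.2 Thm. 3, §8.2 Prop. 26.
* [Gordon1999HodgeAVSurvey] B. B. Gordon, *A survey of the Hodge conjecture for abelian varieties*, Thm. 6.4, §9.3.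
-/

noncomputable section

open CategoryTheory CategoryTheory.Limits NumberField
open scoped BigOperators

namespace Summit.HodgeConjecture.CorCM.SplitInvolution

open Literature.NumberTheory.ComplexMultiplication
open Literature.AlgebraicGeometry.Motives (AbelianVariety CMType)
open Literature.AlgebraicGeometry.HodgeTheory
open Literature.AlgebraicGeometry.ComplexMultiplication (IsCMTypeRealisation)
open Literature.AlgebraicGeometry.Pohlmann1968
open Literature.Barriers.HodgeConjecture (divisorClassesSpan)

section Field

variable {K : Type} [Field K] [NumberField K] [IsCMField K] [IsGalois ℚ K]

/-- **`Dic_m × C₂` (complex conjugation `(aᵐ, 1)`) is BAD whenever `ℤ/2m` has a non-zero `u` with `m ∉ ⟨u⟩`** — i.e. whenever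
`m` is not a power of `2` (`u = 2^{k+1}` for `m = 2ᵏm'`, `m' > 1` odd): a simple DEGENERATE abelian variety of dimension `4m` with
CM by `K`. [cite: Kubota1965, §2 and §4 Lemma 2] [cite: Shimura1998, §6.2 Thm. 3 and §8.2 Prop. 26]
[cite: Gordon1999HodgeAVSurvey, Thm. 6.4 and §9.3] -/
theorem exists_simple_degenerate_dicyclic_times_two_of_notMem {m : ℕ} [NeZero m] (hm3 : 3 ≤ m) (u : ZMod (2 * m))
    (hu : u ≠ 0) (hmu : (m : ZMod (2 * m)) ∉ AddSubgroup.zmultiples u)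
    (e : (K ≃ₐ[ℚ] K) ≃* QuaternionGroup m × Multiplicative (ZMod 2))
    (hc : e ((IsCMField.complexConj K).restrictScalars ℚ) = (QuaternionGroup.a m, 1)) :
    ∃ (Φ : CMType K) (φ₀ : K →+* ℂ) (X : AbelianVariety ℂ) (ι : 𝓞 K →+* End X)
      (ϑ : K →+* Module.End ℂ (complexBetti X.X 1)),
      IsPrimitive (ℂ ≃+* ℂ) Φ.1 φ₀ ∧ ¬ IsNondegenerate Φ ∧ IsCMTypeRealisation Φ X ι ϑ ∧ X.IsSimple ∧ X.dim = 4 * m ∧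
      ∃ n p : ℕ, ∃ y : complexBetti (⨁ fun _ : Fin n => X).X (2 * p), IsRationalClass y ∧
        IsOfHodgeType (⨁ fun _ : Fin n => X).dim (⨁ fun _ : Fin n => X).X (2 * p) p p y ∧
        y ∉ divisorClassesSpan (⨁ fun _ : Fin n => X).X (⨁ fun _ : Fin n => X).dim p := by
  classical
  haveI : NeZero (2 * m) := ⟨by have := NeZero.ne m; omega⟩
  let i₁ : Multiplicative (ZMod (2 * m)) →* QuaternionGroup m :=
    MonoidHom.mk' (fun t => QuaternionGroup.a (Multiplicative.toAdd t)) fun t t' => by simp [toAdd_mul, QuaternionGroup.a_mul_a]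
  let i : Multiplicative (ZMod (2 * m)) × Multiplicative (ZMod 2) →* QuaternionGroup m × Multiplicative (ZMod 2) :=
    MonoidHom.prodMap i₁ (MonoidHom.id _)
  have hi_apply : ∀ t v, i (t, v) = (QuaternionGroup.a (Multiplicative.toAdd t), v) := fun t v => rfl
  have hi : Function.Injective i := by
    rintro ⟨t, v⟩ ⟨t', v'⟩ h
    simp only [hi_apply, Prod.mk.injEq, QuaternionGroup.a.injEq] at h
    exact Prod.ext (by simpa using h.1) h.2
  set x : QuaternionGroup m × Multiplicative (ZMod 2) := (QuaternionGroup.xa 0, 1) with hx_def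
  have hx : ∀ w, i w ≠ x := fun ⟨t, v⟩ => by simp [hi_apply, hx_def]
  have hcov : ∀ g : QuaternionGroup m × Multiplicative (ZMod 2), (∃ w, g = i w) ∨ (∃ w, g = i w * x) := by
    rintro ⟨j | j, v⟩
    · exact Or.inl ⟨(Multiplicative.ofAdd j, v), by simp [hi_apply]⟩
    · exact Or.inr ⟨(Multiplicative.ofAdd (-j), v), by simp [hi_apply, hx_def, QuaternionGroup.a_mul_xa]⟩
  have hθ : ∀ (t : Multiplicative (ZMod (2 * m))) (v : Multiplicative (ZMod 2)),
      x * i (t, v) = i ((MulEquiv.inv (Multiplicative (ZMod (2 * m)))) t, v) * x := fun t v => by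
    simp [hi_apply, hx_def, QuaternionGroup.xa_mul_a, QuaternionGroup.a_mul_xa]
  have hic : i (Multiplicative.ofAdd (m : ZMod (2 * m)), 1) = (QuaternionGroup.a m, 1) := rfl
  have hq : x * x = i (Multiplicative.ofAdd (m : ZMod (2 * m)), 1) := by
    rw [hic, hx_def, Prod.mk_mul_mk, mul_one, QuaternionGroup.xa_mul_xa, add_zero, sub_zero]
  have hu' : Multiplicative.ofAdd u ≠ 1 := fun h => hu (by simpa using congrArg Multiplicative.toAdd h)
  have hcu : Multiplicative.ofAdd (m : ZMod (2 * m)) ∉ Subgroup.zpowers (Multiplicative.ofAdd u) := by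
    rw [Subgroup.mem_zpowers_iff]
    rintro ⟨k, hk⟩
    exact hmu (AddSubgroup.mem_zmultiples_iff.2 ⟨k, by simpa using congrArg Multiplicative.toAdd hk⟩)
  have hcard : 4 < Fintype.card (Multiplicative (ZMod (2 * m))) := by
    rw [Fintype.card_multiplicative, ZMod.card]; omega
  obtain ⟨Φ, φ₀, X, ι, ϑ, h1, h2, h3, h4, h5, h6⟩ := exists_simple_degenerate_of_index_two_times_two e i hi x hx hcov
    (MulEquiv.inv _) hθ _ hq (Multiplicative.ofAdd (m : ZMod (2 * m))) (by rw [hic]; exact hc) _ hu' hcu hcard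
  refine ⟨Φ, φ₀, X, ι, ϑ, h1, h2, h3, h4, ?_, h6⟩
  rw [h5, Fintype.card_prod, Fintype.card_multiplicative, ZMod.card, QuaternionGroup.card, Nat.mul_div_cancel _ Nat.two_pos]

/-- **`Dic_m × C₂` (`m` ODD, `m ≥ 3`, complex conjugation `(aᵐ, 1)`) is BAD** (`u = 2`: `m ∉ 2ℤ/2m` by parity): a simple
DEGENERATE abelian variety of dimension `4m` with CM by `K`.  With gen 20's `Q_{2^{k+2}} × C₂` GOOD: `Dic_m × C₂` is GOOD iff `m`
is a power of `2`. [cite: Kubota1965, §2 and §4 Lemma 2] [cite: Shimura1998, §6.2 Thm. 3 and §8.2 Prop. 26]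
[cite: Gordon1999HodgeAVSurvey, Thm. 6.4 and §9.3] -/
theorem exists_simple_degenerate_dicyclic_odd_times_two {m : ℕ} [NeZero m] (hm : m % 2 = 1) (hm3 : 3 ≤ m)
    (e : (K ≃ₐ[ℚ] K) ≃* QuaternionGroup m × Multiplicative (ZMod 2))
    (hc : e ((IsCMField.complexConj K).restrictScalars ℚ) = (QuaternionGroup.a m, 1)) :
    ∃ (Φ : CMType K) (φ₀ : K →+* ℂ) (X : AbelianVariety ℂ) (ι : 𝓞 K →+* End X)
      (ϑ : K →+* Module.End ℂ (complexBetti X.X 1)),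
      IsPrimitive (ℂ ≃+* ℂ) Φ.1 φ₀ ∧ ¬ IsNondegenerate Φ ∧ IsCMTypeRealisation Φ X ι ϑ ∧ X.IsSimple ∧ X.dim = 4 * m ∧
      ∃ n p : ℕ, ∃ y : complexBetti (⨁ fun _ : Fin n => X).X (2 * p), IsRationalClass y ∧
        IsOfHodgeType (⨁ fun _ : Fin n => X).dim (⨁ fun _ : Fin n => X).X (2 * p) p p y ∧
        y ∉ divisorClassesSpan (⨁ fun _ : Fin n => X).X (⨁ fun _ : Fin n => X).dim p := by
  haveI : NeZero (2 * m) := ⟨by have := NeZero.ne m; omega⟩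
  let π : ZMod (2 * m) →+* ZMod 2 := ZMod.castHom (dvd_mul_right 2 m) (ZMod 2)
  have hπm : π (m : ZMod (2 * m)) = 1 := by
    rw [map_natCast, ← ZMod.natCast_mod, hm, Nat.cast_one]
  have hπ2 : π 2 = 0 := by rw [map_ofNat]; decide
  have h20 : (2 : ZMod (2 * m)) ≠ 0 := by
    intro h
    have : ((2 : ℕ) : ZMod (2 * m)) = 0 := by exact_mod_cast h
    rw [ZMod.natCast_eq_zero_iff] at this
    exact absurd (Nat.le_of_dvd (by norm_num) this) (by omega)
  refine exists_simple_degenerate_dicyclic_times_two_of_notMem hm3 2 h20 ?_ e hc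
  rw [AddSubgroup.mem_zmultiples_iff]
  rintro ⟨k, hk⟩
  have h := congrArg π hk
  rw [map_zsmul, hπ2, smul_zero, hπm] at h
  exact zero_ne_one h

end Field

end Summit.HodgeConjecture.CorCM.SplitInvolution

end
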